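import Summits.ABC.IUTFork.LanaLogTheta
import Summits.ABC.IUTFork.LanaGoodPlace
import HarnessLib

/-!
# L-LANA objects XI: non-vacuity witnesses at a `ℚ_p`-place (the cell's vacuity audit, LANA Rem. 8.2.1 spirit)

Record-only file (D-0012) of the abc-iut cell (seat abc-iut-c312-4, L-LANA level); TAKES NO SIDE on
[IUTchIII] Cor. 3.12. The cell's rule (HOME/README: "vacuity-audit every fork-level hypothesis … with a
non-vacuity witness as skel/ForkChecks does") applied to the L-LANA interfaces: every structure typed in
`LanaGMData` / `LanaStrips` / `LanaThetaLink` / `LanaLogTheta` is INHABITED over the genuine reference datum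
at `K_v = ℚ_p` of `LanaPadicGalois` (`G_{ℚ_p} ↷ ℚ̄_p`, valuation-preserving and continuous — theorems there),
so none of the typed hypotheses is vacuously unsatisfiable, and the "vacuous link" phenomenon of Rem. 8.2.1
p. 42 is exhibited on real objects (`padicThetaLink_gluing_nonempty`).

THE ONE PLACEHOLDER (flagged): the witnesses use `padicRef` of `LanaGoodPlace` (`Π_v := G_v`,
`Π_v ↠ G_v := id`); `RefLocalDatum.ofExtension` there plugs a genuine profinite `Π_v ↠ G_v` from L4-t1's
interface, and the tempered `π₁` of the Tate curve (§3.8 (a) (b1)) is seat abc-iut-L3-t2's. Value-group portions: one place,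
`C = ℝ`, pilot `1` (any positive local degree; the printed ones are `LanaDegrees.QPilotInput.d`).
[cite: LANA2026Report, Rem. 8.2.1 p. 42, §3.8 (a) pp. 20–21] NOT here: any judgement.
-/

noncomputable section

namespace Summit.ABC
namespace IUTFork

open scoped NNReal

variable (p : ℕ) [Fact p.Prime]

/-- One place `v` (index type `Unit`), all bad. [folklore] -/
abbrev refOne : Unit → RefLocalDatum := fun _ => padicRef p

/-- A value-group BPS over one bad place: `C = ℝ`, local pilot `1`. [cite: LANA2026Report, Def. 4.1.3 p. 23] -/
def unitLineBPS : ValueGroupBPS Unit Finset.univ where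
  C := ℝ
  rank_one := Module.finrank_self ℝ
  φ _ := 1
  φ_ne _ := one_ne_zero
  pilot_ne := by simp

/-- **Def. 4.1.2/4.1.6 inhabited over `ℚ_p`**: the standard étale-unit BPS `{(G_{ℚ_p} ↷ O^{×μ}_{ℚ̄_p}, I^κ)}`
paired with the one-place value group. [cite: LANA2026Report, Def. 4.1.6 p. 24] -/
def padicBPS : LanaBPS (refUnitMu (refOne p)) Finset.univ :=
  ⟨EtaleUnitBPS.std _, unitLineBPS⟩

/-- **§7.1 (b) inhabited**: a Θ-link datum (here between `padicBPS` and itself).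
[cite: LANA2026Report, §7.1 (b) p. 38] -/
def padicThetaLink : ThetaLink (refUnitMu (refOne p)) Finset.univ := ⟨padicBPS p, padicBPS p, rfl⟩

/-- **Rem. 8.2.1 on real objects**: the gluing of `padicThetaLink` is nonempty ("vacuous assertion").
[cite: LANA2026Report, Rem. 8.2.1 p. 42] -/
theorem padicThetaLink_gluing_nonempty : (padicThetaLink p).gluing.Nonempty :=
  (padicThetaLink p).gluing_nonempty

/-- **Step 1 is executable over `ℚ_p`**: a realisation of the étale-unit portion exists.
[cite: LANA2026Report, §6.2 (b) p. 33] -/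
theorem padic_realisation_nonempty : Nonempty (Realisation (padicBPS p).unit) :=
  realisation_nonempty _

/-- **§3.10 inhabited**: the reference `F`-prime-strip `{Π_v ↷ O^▷_{ℚ̄_p}}` (placeholder `Π_v`).
[cite: LANA2026Report, §3.10 p. 23] -/
def padicFStrip : FPrimeStrip (refOne p) := GMFamily.std _

/-- **§4.2 (a) interface inhabited**: a Hodge theater carrier at `ℚ_p` (both pilots = `padicBPS`).
[cite: LANA2026Report, §4.2 (a) p. 25] -/
def padicHT : HodgeTheater (refOne p) Finset.univ where
  F := padicFStrip p
  qBPS := padicBPS p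
  thetaBPS := padicBPS p
  unit_eq := rfl
  PF_eq := rfl

/-- **§5.3 (a) inhabited**: the identity log-link on `padicHT`. [cite: LANA2026Report, §5.3 (a) p. 29] -/
def padicLogLink : LogLink (padicHT p) (padicHT p) where
  etaleIso := DPrimeStrip.Iso.refl _
  lift _ := GMData.Iso.refl _
  lift_etale _ := rfl

/-- **§5.3 (b) inhabited**: the constant log sequence. [cite: LANA2026Report, §5.3 (b) p. 30] -/
def padicLogSequence : LogSequence (refOne p) Finset.univ := ⟨fun _ => padicHT p, fun _ => padicLogLink p⟩

/-- **§7.2 / §8.1 (g) inhabited**: a big-H diagram over `ℚ_p` (two constant columns, Θ-link at every level).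
[cite: LANA2026Report, §7.2 (a) p. 38] -/
def padicBigH : BigH (refOne p) Finset.univ := ⟨padicLogSequence p, padicLogSequence p, fun _ => rfl⟩

/-- Every level of the witness big-H has a nonempty Θ-gluing. [cite: LANA2026Report, Rem. 8.2.1 p. 42] -/
theorem padicBigH_gluing_nonempty (m : ℤ) : ((padicBigH p).thetaLink m).gluing.Nonempty :=
  (padicBigH p).thetaLink_gluing_nonempty m

/-- The reference étale-unit datum at `ℚ_p` is mono-analytic GM-data in the sense of §3.7 (trivially: it IS
the reference) — the predicates of `LanaStrips` are satisfiable by real objects. [cite: LANA2026Report, §3.7 p. 20] -/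
theorem padic_isMonoAnalytic : GMData.IsMonoAnalytic (padicRef p) (padicRef p).FunitMu.toGMData :=
  (padicRef p).isMonoAnalytic_FunitMu

end IUTFork

end Summit.ABC

end
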